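import Mathlib
import Summits.Ventures.HodgeRepro.Tier4.Target
import Summits.Ventures.HodgeRepro.Tier4.Line3.Defs
import Summits.Ventures.HodgeRepro.Tier4.Line3.DefsLemmas
import Summits.Ventures.HodgeRepro.Tier4.Line3.TorusInvariance
import Summits.Ventures.HodgeRepro.Tier4.Line3.CoefInvariance
import Summits.Ventures.HodgeRepro.Tier4.Line3.MainClassReps
import Summits.Ventures.HodgeRepro.Tier4.Line3.KernelIntegrable
import Summits.Ventures.HodgeRepro.Tier4.Line3.UnitCopyScaling
import Summits.Ventures.HodgeRepro.Tier4.Line3.UnitCopySphere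
import Summits.Ventures.HodgeRepro.Tier4.Line3.ScalarCopyClassSum

/-!
# Tier4/Line3/ScalarCopyClassSumSphere — the family-sum identity under the SPHERE symmetry (the honest clause for
non-unit scalars, t4-L3-p2 g2 S13561 / UnitCopySphere p681393)

Blind re-derivation cell `pub-hodge-repro`, Tier 4 «PROVE THE STEP» (README §9–§10), LINE L3, seat t4-x2 (reserve
wall-breaker, g2).  `ScalarCopyClassSum` (t4-x2) states `classSum_smul_family` / `term_smul_family` under the global
per-slot symmetry `SlotScalarSymmetric D j (ε j) (lam j)` (∀ x) — true of the natural data for UNIT scalars only; for a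
scalar `ε j` that is not a unit the natural slot function is scalar-symmetric up to a constant only on the SPHERE
`{t · g xm_j}` of the centre (the geometric-sum ratio at `w | N(ε j)` depends on the content of `x` at `w`, constant where
the Gram entry is a unit).  Since the class coefficients are evaluated at `mainRep K xm c = gRep c • xm`, which lies on
the sphere, the identity holds verbatim under the sphere clause `SphereScalarSymmetric D xm j (ε j) (lam j)`:
`coefQ_mainRep_scale_of_sphere`, `classSum_smul_family_of_sphere`, `term_smul_family_of_sphere`.
Nothing here asserts anything about the truth of (P); HC_CM is NOT proved by anyone in this repository.
-/

set_option autoImplicit false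

noncomputable section

namespace Summit.Ventures.HodgeRepro.Tier4.Line3

open Summit.Ventures.HodgeRepro.Tier4
open Matrix MeasureTheory NumberField
open scoped ComplexConjugate

open scoped Classical

namespace T4Data

variable (X : T4Data)

/-- The slots of a main-class representative lie on the spheres of the centre. -/
theorem mainRep_mem_sphere (K : X.Level) (xm : X.Tuple) (c : X.MainClass K xm) (j : Fin 4) :
    X.mainRep K xm c j ∈ X.sphere xm j :=
  ⟨X.gRep K xm c, 1, X.gRep_isUnitaryOf K xm c, by simp, by simp [mainRep]⟩

/-- **THE CLASS COEFFICIENT OF THE COPY, SPHERE FORM.** -/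
theorem coefQ_mainRep_scale_of_sphere (D : X.ThetaData) (K : X.Level) (γ : X.Tr K) {ε : Fin 4 → X.E}
    (hε : ∀ j, ε j ≠ 0) {lam : Fin 4 → ℂ} (xm : X.Tuple)
    (hu : ∀ j, X.SphereScalarSymmetric D xm j (ε j) (lam j)) (c : X.MainClass K xm) :
    X.coefQ D.cf γ (X.mainRep K (fun j => ε j • xm j) (X.scaleMainClass K ε hε xm c)) =
      lam 0 * lam 1 * conj (lam 2 * lam 3) * ((X.gaussRatio ε xm : ℂ) * X.coefQ D.cf γ (X.mainRep K xm c)) := by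
  obtain ⟨δ, hδ, hl⟩ := X.exists_lines_mainRep_scale K ε hε xm c
  obtain ⟨t, ht, hx⟩ := X.exists_torus_of_lines_eq hl.symm
  have e : X.mainRep K (fun j => ε j • xm j) (X.scaleMainClass K ε hε xm c) =
      fun j => t j • (δ *ᵥ (ε j • X.mainRep K xm c j)) := funext hx
  rw [e, X.coefQ_smul D.cf D.weight γ t ht, X.coefQ_mulVec_mem_of_thetaData D γ hδ,
    X.coefQ_smul_of_sphere D hu γ (fun j => X.mainRep_mem_sphere K xm c j), X.gaussRatio_mainRep ε K xm c]

/-- **THE CLASS SUM OF THE COPY, SPHERE FORM**: `classSum (ε • xm) = Λ · gaussRatio ε xm · classSum xm`. -/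
theorem classSum_smul_family_of_sphere (D : X.ThetaData) (K : X.Level) (γ : X.Tr K) {ε : Fin 4 → X.E}
    (hε : ∀ j, ε j ≠ 0) {lam : Fin 4 → ℂ} (xm : X.Tuple)
    (hu : ∀ j, X.SphereScalarSymmetric D xm j (ε j) (lam j)) :
    X.classSum D.cf γ (fun j => ε j • xm j) =
      lam 0 * lam 1 * conj (lam 2 * lam 3) * ((X.gaussRatio ε xm : ℂ) * X.classSum D.cf γ xm) := by
  unfold classSum
  set y' : X.Tuple := fun j => ε j • xm j with hy'
  set f : X.MainClass K y' → ℂ := fun c' =>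
    ((X.centerCard K : ℂ) / (X.stabCard K (X.mainRep K y' c') : ℂ)) * X.coefQ D.cf γ (X.mainRep K y' c') with hf
  have e1 : (∑' c', f c') = ∑' c, f (X.scaleMainClass K ε hε xm c) :=
    ((X.scaleMainClass K ε hε xm).tsum_eq f).symm
  have e2 : ∀ c, f (X.scaleMainClass K ε hε xm c) =
      lam 0 * lam 1 * conj (lam 2 * lam 3) * ((X.gaussRatio ε xm : ℂ) *
        (((X.centerCard K : ℂ) / (X.stabCard K (X.mainRep K xm c) : ℂ)) * X.coefQ D.cf γ (X.mainRep K xm c))) := by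
    intro c
    simp only [hf]
    rw [X.coefQ_mainRep_scale_of_sphere D K γ hε xm hu c, X.stabCard_mainRep_scale K hε xm c]
    ring
  show (∑' c', f c') = _
  rw [e1, tsum_congr e2, tsum_mul_left, tsum_mul_left]

/-- **THE ORBITAL TERM OF THE COPY, SPHERE FORM**: `term (ε • xm) = (∫_𝔹 kernelScale · kernel) · Λ · gaussRatio · classSum xm`. -/
theorem term_smul_family_of_sphere (D : X.ThetaData) (K : X.Level) (γ : X.Tr K) {ε : Fin 4 → X.E}
    (hε : ∀ j, ε j ≠ 0) {lam : Fin 4 → ℂ} (xm : X.Tuple)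
    (hu : ∀ j, X.SphereScalarSymmetric D xm j (ε j) (lam j))
    (hab : X.ballCoord (xm 0) 0 * X.ballCoord (xm 1) 1 - X.ballCoord (xm 0) 1 * X.ballCoord (xm 1) 0 ≠ 0)
    (hD : IsFundamentalDomainFor (ballActions X.τ₀ X.C K.1) (X.domain K))
    (h2 : (∀ z ∈ X.domain K, Summable (fun w : X.LineTuple => ‖X.summand D.Φ D.cf γ w z‖)) ∧
      IntegrableOn (fun z => ∑' w : X.LineTuple, ‖X.summand D.Φ D.cf γ w z‖) (X.domain K)) :
    X.term D.Φ D.cf K γ (X.orbitOf (X.lines (fun j => ε j • xm j))) =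
      (∫ z in ball, ((X.kernelScale ε xm z : ℝ) : ℂ) * X.kernel D.Φ xm z) *
        (lam 0 * lam 1 * conj (lam 2 * lam 3) * ((X.gaussRatio ε xm : ℂ) * X.classSum D.cf γ xm)) := by
  rw [X.term_main_unfold_of_wedge D (fun j => ε j • xm j) (X.wedge_smul_ne xm hε hab) K γ hD h2,
    X.classSum_smul_family_of_sphere D K γ hε xm hu]
  congr 1
  refine setIntegral_congr_fun HeckeEquivariance.isOpen_ball'.measurableSet fun z _ => ?_
  exact X.kernel_smul_family D.Φ ε xm z

end T4Data

end Summit.Ventures.HodgeRepro.Tier4.Line3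

end
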